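import Mathlib
import Literature.Analysis.FluidPDE.VectorCalculus
import Summits.NavierStokesRegularity.NavierStokesRegularity.Theorems.ThreadingFluxErtelTowerKinematicRigidity
import Summits.NavierStokesRegularity.NavierStokesRegularity.Theorems.ThreadingFluxErtelTowerTowerClosure
import HarnessLib

/-!
# Crux `PoloidalLiouville` (stmt-NavierStokesRegularity-1222, W1), crux idea «radial-jerk-tower» (ns-idea-15 g7):
# JET RIGIDITY — the inviscid shadow about a NON-STAGNATION centre of a GENERAL smooth steady drift

Support file (`--supports stmt-NavierStokesRegularity-1222`, helper).  Experiment cell `ns-wall-extremal`, width hand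
ns-wall-eng-5 g8, item (ε) E5 (the first statement of the (ε) family about a NONLINEAR drift, not its affine model).  0 kit.

Let `u` be a smooth steady drift on an open `U ∋ x₀`, `v = u(x₀)`, `A = Du(x₀)`.  The first two gradients of the radial-jerk tower
about `x₀` AT THE CENTRE depend on the 1-jet only:

  `∇θ₁(x₀) = v`,   `∇θ₂(x₀) = A v + 2 A† v`           (`gradient_thetaOne_centre`, `gradient_thetaTwo_centre`),

so the `inviscidKinematicRigidity` discriminant `D(x) = ⟪x − x₀, ∇θ₁(x) × ∇θ₂(x)⟫` has `D(x₀) = 0` and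
`∇D(x₀) = v × (A v + 2A† v)` (`gradient_disc_centre`).  If this vector is non-zero, `D` is a submersion near `x₀`, its zero set has
empty interior there (`subset_closure_ne_zero_of_fderiv_ne_zero`: a `C¹` function with nowhere-vanishing derivative is non-zero on a dense
set), and `inviscidKinematicRigidity` BY NAME gives:

* ★★ `inviscidJetRigidity_nonStagnation` — **if `v × (A v + 2A†v) ≠ 0` at `x₀`, there is a ball `B(x₀, r) ⊆ U` on which every smooth field
  frozen into `u` (`∂ₜB + DB[u] − Du[B] = 0` on `I × B(x₀,r)`, `I` open) and tangent to the spheres about `x₀` VANISHES identically.**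

The condition is an explicit, generic inequality on the 1-jet `(u(x₀), Du(x₀))`; for the affine model `v + A(x − x₀)` it is exactly the
non-vanishing of the LINEAR part of the affine discriminant of `…AffineFlowFrame`/`…AffineFlowDichotomy` (whose quadratic and cubic parts
are NOT jet-universal for a nonlinear drift).

HONEST FRAME: a LOCAL statement about the INVISCID shadow (frozen-field equation) in a prescribed smooth steady drift; information-grade
helper under ⟨1222⟩; says nothing about NS; `PoloidalLiouville` (1222) / (27585) OPEN; NS regularity NOT proved.
-/

-- the summit and its single problem share the name (D-0017 nested layout)
set_option linter.dupNamespace false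

noncomputable section

namespace Summit.NavierStokesRegularity.NavierStokesRegularity.Theorems.PoloidalLiouville.ErtelTower

open Set Function Filter Metric Topology
open scoped Topology RealInnerProductSpace InnerProductSpace
open Literature.Analysis.FluidPDE
open Summit.NavierStokesRegularity.NavierStokesRegularity.Theorems.PoloidalLiouville.HorizonTower (E3)

/-! ### Gradients of `⟪G y, y − x₀⟫` and `‖u y‖²` -/

section Gradients

variable {G u : E3 → E3} {x x₀ : E3}

/-- `∇⟪G y, y − x₀⟫(x) = (DG x)†(x − x₀) + G x` for `G` differentiable at `x`. -/
theorem gradient_inner_sub_centre (hG : DifferentiableAt ℝ G x) :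
    gradient (fun y : E3 => ⟪G y, y - x₀⟫) x = (ContinuousLinearMap.adjoint (fderiv ℝ G x)) (x - x₀) + G x := by
  have hd : HasFDerivAt (fun y : E3 => ⟪G y, y - x₀⟫)
      ((fderivInnerCLM ℝ (G x, x - x₀)).comp ((fderiv ℝ G x).prod (ContinuousLinearMap.id ℝ E3))) x :=
    hG.hasFDerivAt.inner ℝ ((hasFDerivAt_id x).sub_const x₀)
  apply ext_inner_right ℝ
  intro w
  rw [_root_.inner_gradient_left, hd.fderiv, inner_add_left, ContinuousLinearMap.adjoint_inner_left]
  simp only [ContinuousLinearMap.comp_apply, fderivInnerCLM_apply, ContinuousLinearMap.prod_apply,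
    ContinuousLinearMap.id_apply]
  rw [real_inner_comm (x - x₀)]
  ring

/-- At the centre the derivative term drops out: `∇⟪G y, y − x₀⟫(x₀) = G x₀`. -/
theorem gradient_inner_sub_centre_self (hG : DifferentiableAt ℝ G x₀) :
    gradient (fun y : E3 => ⟪G y, y - x₀⟫) x₀ = G x₀ := by
  rw [gradient_inner_sub_centre hG, sub_self, map_zero, zero_add]

/-- `∇‖u‖²(x) = 2 (Du x)† (u x)` (as `⟪u, u⟫`). -/
theorem gradient_inner_self_drift (hu : DifferentiableAt ℝ u x) :
    gradient (fun y : E3 => ⟪u y, u y⟫) x = (2 : ℝ) • (ContinuousLinearMap.adjoint (fderiv ℝ u x)) (u x) := by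
  have hd := hu.hasFDerivAt.inner ℝ hu.hasFDerivAt
  apply ext_inner_right ℝ
  intro w
  rw [_root_.inner_gradient_left, hd.fderiv, real_inner_smul_left, ContinuousLinearMap.adjoint_inner_left]
  simp only [ContinuousLinearMap.comp_apply, fderivInnerCLM_apply, ContinuousLinearMap.prod_apply]
  rw [real_inner_comm (u x)]
  ring

end Gradients

/-! ### The first two tower gradients of a steady drift at the centre -/

section Tower

variable {u : E3 → E3} {U : Set E3} {x₀ : E3}

/-- `θ₁ = ⟪u, · − x₀⟫` for the steady drift. -/
theorem thetaOne_steady (u : E3 → E3) (x₀ : E3) :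
    radialJerk (fun _ : ℝ => u) x₀ 1 0 = fun y => ⟪u y, y - x₀⟫ :=
  funext fun y => radialJerk_one (fun _ : ℝ => u) x₀ 0 y

/-- `∇θ₁(x) = (Du x)†(x − x₀) + u x`. -/
theorem gradient_thetaOne_steady {x : E3} (hu : DifferentiableAt ℝ u x) :
    gradient (radialJerk (fun _ : ℝ => u) x₀ 1 0) x = (ContinuousLinearMap.adjoint (fderiv ℝ u x)) (x - x₀) + u x := by
  rw [thetaOne_steady, gradient_inner_sub_centre hu]

/-- ★ `∇θ₁(x₀) = u(x₀)` — the first tower gradient at the centre is the drift itself. -/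
theorem gradient_thetaOne_centre (hu : DifferentiableAt ℝ u x₀) :
    gradient (radialJerk (fun _ : ℝ => u) x₀ 1 0) x₀ = u x₀ := by
  rw [thetaOne_steady, gradient_inner_sub_centre_self hu]

/-- `θ₂ = ⟪Du·u, · − x₀⟫ + ‖u‖²` on `U` for a drift smooth on the open `U`. -/
theorem thetaTwo_steady_eq (hU : IsOpen U) (hu : ContDiffOn ℝ (⊤ : ℕ∞) u U) {y : E3} (hy : y ∈ U) :
    radialJerk (fun _ : ℝ => u) x₀ 2 0 y = ⟪fderiv ℝ u y (u y), y - x₀⟫ + ⟪u y, u y⟫ := by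
  have hud : DifferentiableAt ℝ u y := (hu.differentiableOn (by simp)).differentiableAt (hU.mem_nhds hy)
  rw [radialJerk_succ_steady, gradient_thetaOne_steady hud, inner_add_right, ContinuousLinearMap.adjoint_inner_right]

/-- ★ `∇θ₂(x₀) = A v + 2 A† v` with `v = u(x₀)`, `A = Du(x₀)` — the second tower gradient at the centre depends on the 1-jet only. -/
theorem gradient_thetaTwo_centre (hU : IsOpen U) (hu : ContDiffOn ℝ (⊤ : ℕ∞) u U) (hx₀ : x₀ ∈ U) :
    gradient (radialJerk (fun _ : ℝ => u) x₀ 2 0) x₀ =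
      fderiv ℝ u x₀ (u x₀) + (2 : ℝ) • (ContinuousLinearMap.adjoint (fderiv ℝ u x₀)) (u x₀) := by
  have hud : DifferentiableAt ℝ u x₀ := (hu.differentiableOn (by simp)).differentiableAt (hU.mem_nhds hx₀)
  -- `y ↦ Du(y)[u(y)]` is differentiable at `x₀`
  have hDu : ContDiffOn ℝ (⊤ : ℕ∞) (fderiv ℝ u) U := hu.fderiv_of_isOpen hU (by simp)
  have hG : DifferentiableAt ℝ (fun y => fderiv ℝ u y (u y)) x₀ :=
    ((hDu.differentiableOn (by simp)).differentiableAt (hU.mem_nhds hx₀)).clm_apply hud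
  have hev : radialJerk (fun _ : ℝ => u) x₀ 2 0 =ᶠ[𝓝 x₀]
      fun y => ⟪fderiv ℝ u y (u y), y - x₀⟫ + ⟪u y, u y⟫ := by
    filter_upwards [hU.mem_nhds hx₀] with y hy using thetaTwo_steady_eq hU hu hy
  rw [(gradient_congr_nhds hev).eq_of_nhds]
  -- gradient of the sum
  have hd1 : DifferentiableAt ℝ (fun y : E3 => ⟪fderiv ℝ u y (u y), y - x₀⟫) x₀ :=
    hG.inner ℝ ((differentiableAt_id).sub_const x₀)
  have hd2 : DifferentiableAt ℝ (fun y : E3 => ⟪u y, u y⟫) x₀ := hud.inner ℝ hud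
  have hsum : (fun y : E3 => ⟪fderiv ℝ u y (u y), y - x₀⟫ + ⟪u y, u y⟫)
      = (fun y : E3 => ⟪fderiv ℝ u y (u y), y - x₀⟫) + fun y : E3 => ⟪u y, u y⟫ := rfl
  rw [hsum, gradient, fderiv_add hd1 hd2, map_add]
  change gradient (fun y : E3 => ⟪fderiv ℝ u y (u y), y - x₀⟫) x₀ + gradient (fun y : E3 => ⟪u y, u y⟫) x₀ = _
  rw [gradient_inner_sub_centre_self hG, gradient_inner_self_drift hud]

end Tower

/-! ### A `C¹` function with nowhere-vanishing derivative is non-zero on a dense set -/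

section Density

/-- If `f` has non-zero derivative at every point of the open `V`, then `{y ∈ V | f y ≠ 0}` is dense in `V`: were `f ≡ 0` near a point
`y ∈ V`, its derivative at `y` would vanish. -/
theorem subset_closure_ne_zero_of_fderiv_ne_zero {f : E3 → ℝ} {V : Set E3} (hV : IsOpen V)
    (hf : ∀ y ∈ V, fderiv ℝ f y ≠ 0) : V ⊆ closure {y | y ∈ V ∧ f y ≠ 0} := by
  intro y hy
  rw [mem_closure_iff_nhds]
  intro t ht
  by_contra hempty
  rw [Set.not_nonempty_iff_eq_empty] at hempty
  have hzero : ∀ w ∈ t ∩ V, f w = 0 := by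
    intro w hw
    by_contra hne
    have : w ∈ t ∩ {y | y ∈ V ∧ f y ≠ 0} := ⟨hw.1, hw.2, hne⟩
    rw [hempty] at this
    exact this
  have hev : f =ᶠ[𝓝 y] fun _ => (0 : ℝ) := by
    filter_upwards [inter_mem ht (hV.mem_nhds hy)] with w hw using hzero w hw
  exact hf y hy (by rw [hev.fderiv_eq]; simp)

end Density

/-! ### Jet rigidity -/

section Jet

variable {u : E3 → E3} {U : Set E3} {x₀ : E3}

/-- The tower gradients of a drift smooth on the open `U` are smooth on `U`. -/
theorem contDiffOn_gradient_radialJerk_steady (hU : IsOpen U) (hu : ContDiffOn ℝ (⊤ : ℕ∞) u U) (x₀ : E3) (k : ℕ) :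
    ContDiffOn ℝ (⊤ : ℕ∞) (gradient (radialJerk (fun _ : ℝ => u) x₀ k 0)) U := by
  have h : ContDiffOn ℝ (⊤ : ℕ∞) (fderiv ℝ (radialJerk (fun _ : ℝ => u) x₀ k 0)) U :=
    (contDiffOn_radialJerk_steady hU hu x₀ k).fderiv_of_isOpen hU (by simp)
  exact (InnerProductSpace.toDual ℝ E3).symm.contDiff.comp_contDiffOn h

/-- ★ **The gradient of the discriminant at the centre is jet-universal**: with `D(x) = ⟪x − x₀, ∇θ₁(x) × ∇θ₂(x)⟫`,
`∇D(x₀) = v × (A v + 2A† v)`, `v = u(x₀)`, `A = Du(x₀)`. -/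
theorem gradient_disc_centre (hU : IsOpen U) (hu : ContDiffOn ℝ (⊤ : ℕ∞) u U) (hx₀ : x₀ ∈ U) :
    gradient (fun x : E3 => ⟪x - x₀, cross (gradient (radialJerk (fun _ : ℝ => u) x₀ 1 0) x)
        (gradient (radialJerk (fun _ : ℝ => u) x₀ 2 0) x)⟫) x₀
      = cross (u x₀) (fderiv ℝ u x₀ (u x₀) + (2 : ℝ) • (ContinuousLinearMap.adjoint (fderiv ℝ u x₀)) (u x₀)) := by
  have hud : DifferentiableAt ℝ u x₀ := (hu.differentiableOn (by simp)).differentiableAt (hU.mem_nhds hx₀)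
  have hg : ∀ k, DifferentiableAt ℝ (gradient (radialJerk (fun _ : ℝ => u) x₀ k 0)) x₀ := fun k =>
    ((contDiffOn_gradient_radialJerk_steady hU hu x₀ k).differentiableOn (by simp)).differentiableAt (hU.mem_nhds hx₀)
  have hH : DifferentiableAt ℝ (fun x : E3 => cross (gradient (radialJerk (fun _ : ℝ => u) x₀ 1 0) x)
      (gradient (radialJerk (fun _ : ℝ => u) x₀ 2 0) x)) x₀ := by
    have h := (hasFDerivAt_cross (hg 1).hasFDerivAt (hg 2).hasFDerivAt).differentiableAt
    exact h
  have hsymm : (fun x : E3 => ⟪x - x₀, cross (gradient (radialJerk (fun _ : ℝ => u) x₀ 1 0) x)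
        (gradient (radialJerk (fun _ : ℝ => u) x₀ 2 0) x)⟫)
      = fun x => ⟪cross (gradient (radialJerk (fun _ : ℝ => u) x₀ 1 0) x)
          (gradient (radialJerk (fun _ : ℝ => u) x₀ 2 0) x), x - x₀⟫ := by
    funext x; rw [real_inner_comm]
  rw [hsymm, gradient_inner_sub_centre_self hH, gradient_thetaOne_centre hud, gradient_thetaTwo_centre hU hu hx₀]

set_option maxHeartbeats 400000 in
/-- ★★ **JET RIGIDITY AT A NON-STAGNATION CENTRE (general smooth steady drift).**  Let `u` be smooth on an open `U ∋ x₀`, `v = u(x₀)`,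
`A = Du(x₀)`, and suppose `v × (A v + 2A† v) ≠ 0`.  Then there is a ball `B(x₀, r) ⊆ U` such that every smooth field `B` frozen into
`u` on `I × B(x₀, r)` (`I` open: `∂ₜB + DB[u] − Du[B] = 0`) and tangent to the spheres about `x₀` vanishes identically there.
(The discriminant `D` of `inviscidKinematicRigidity` has `∇D(x₀) = v × (Av + 2A†v) ≠ 0`, hence non-vanishing derivative on a ball,
hence `{D ≠ 0}` is dense in that ball.) -/
theorem inviscidJetRigidity_nonStagnation (u : E3 → E3) (x₀ : E3) (U : Set E3) (hU : IsOpen U) (hx₀ : x₀ ∈ U)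
    (hu : ContDiffOn ℝ (⊤ : ℕ∞) u U)
    (hjet : cross (u x₀) (fderiv ℝ u x₀ (u x₀) + (2 : ℝ) • (ContinuousLinearMap.adjoint (fderiv ℝ u x₀)) (u x₀)) ≠ 0) :
    ∃ r : ℝ, 0 < r ∧ Metric.ball x₀ r ⊆ U ∧
      ∀ (B : ℝ → E3 → E3) (I : Set ℝ), IsOpen I →
        ContDiffOn ℝ (⊤ : ℕ∞) (uncurry B) (I ×ˢ Metric.ball x₀ r) →
        (∀ t ∈ I, ∀ x ∈ Metric.ball x₀ r,
          deriv (fun s => B s x) t + fderiv ℝ (B t) x (u x) - fderiv ℝ u x (B t x) = 0) →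
        (∀ t ∈ I, ∀ x ∈ Metric.ball x₀ r, ⟪B t x, x - x₀⟫ = 0) →
        ∀ t ∈ I, ∀ x ∈ Metric.ball x₀ r, B t x = 0 := by
  -- the discriminant and its smoothness on `U`
  set D : E3 → ℝ := fun x => ⟪x - x₀, cross (gradient (radialJerk (fun _ : ℝ => u) x₀ 1 0) x)
      (gradient (radialJerk (fun _ : ℝ => u) x₀ 2 0) x)⟫ with hDdef
  have hg : ∀ k, ContDiffOn ℝ (⊤ : ℕ∞) (gradient (radialJerk (fun _ : ℝ => u) x₀ k 0)) U :=
    contDiffOn_gradient_radialJerk_steady hU hu x₀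
  have hH : ContDiffOn ℝ (⊤ : ℕ∞) (fun x : E3 => cross (gradient (radialJerk (fun _ : ℝ => u) x₀ 1 0) x)
      (gradient (radialJerk (fun _ : ℝ => u) x₀ 2 0) x)) U := by
    have h : ContDiffOn ℝ (⊤ : ℕ∞) (fun x : E3 => crossCLM (gradient (radialJerk (fun _ : ℝ => u) x₀ 1 0) x)
        (gradient (radialJerk (fun _ : ℝ => u) x₀ 2 0) x)) U :=
      crossCLM.isBoundedBilinearMap.contDiff.comp_contDiffOn ((hg 1).prodMk (hg 2))
    simpa only [crossCLM_apply] using h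
  have hD : ContDiffOn ℝ (⊤ : ℕ∞) D U := ((contDiff_id.sub contDiff_const).contDiffOn).inner ℝ hH
  have hDf : ContinuousOn (fderiv ℝ D) U := hD.continuousOn_fderiv_of_isOpen hU (by simp)
  -- `∇D(x₀) ≠ 0`, hence `DD ≠ 0` on a ball inside `U`
  have hD0 : fderiv ℝ D x₀ ≠ 0 := by
    intro h0
    have hgrad : gradient D x₀ = 0 := by rw [gradient, h0, map_zero]
    rw [hDdef, gradient_disc_centre hU hu hx₀] at hgrad
    exact hjet hgrad
  have hne : {L : E3 →L[ℝ] ℝ | L ≠ 0} ∈ 𝓝 (fderiv ℝ D x₀) := isOpen_ne.mem_nhds hD0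
  have hpre : ∀ᶠ y in 𝓝 x₀, y ∈ U ∧ fderiv ℝ D y ≠ 0 := by
    have h1 : ∀ᶠ y in 𝓝 x₀, fderiv ℝ D y ∈ {L : E3 →L[ℝ] ℝ | L ≠ 0} :=
      (hDf.continuousAt (hU.mem_nhds hx₀)).preimage_mem_nhds hne
    filter_upwards [hU.mem_nhds hx₀, h1] with y hy hy' using ⟨hy, hy'⟩
  obtain ⟨r, hr, hball⟩ := Metric.eventually_nhds_iff_ball.mp hpre
  refine ⟨r, hr, fun y hy => (hball y hy).1, fun B I hI hB hfrozen htan => ?_⟩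
  -- `inviscidKinematicRigidity` on `I × B(x₀, r)`
  have hsub : Metric.ball x₀ r ⊆ U := fun y hy => (hball y hy).1
  have hu' : ContDiffOn ℝ (⊤ : ℕ∞) (uncurry fun (_ : ℝ) (z : E3) => u z) (I ×ˢ Metric.ball x₀ r) :=
    (hu.mono hsub).comp contDiffOn_snd fun p hp => hp.2
  refine inviscidKinematicRigidity (fun _ : ℝ => u) B x₀ I (Metric.ball x₀ r) hI Metric.isOpen_ball hu' hB hfrozen htan
    (fun t _ => ?_)
  -- the closure condition: the tower is steady, and `{D ≠ 0}` is dense in the ball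
  have hdense := subset_closure_ne_zero_of_fderiv_ne_zero (f := D) Metric.isOpen_ball (fun y hy => (hball y hy).2)
  rw [radialJerk_steady u x₀ 1 t 0, radialJerk_steady u x₀ 2 t 0]
  exact hdense

end Jet

end Summit.NavierStokesRegularity.NavierStokesRegularity.Theorems.PoloidalLiouville.ErtelTower

end
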